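/-
Copyright (c) 2026 the pub-hodgecm-mathlib formalisation cell (harness21).  Prover seat hodgecm-mathlib-K2Liu-p02 (g10), Track B «K2-LIT» ∕ hLiu418
#184♮, Road I v3, unit U5 «THE CLOSE», FACE-D₀ (theta side, route (B3) «global unfolding», LEAD F0P6-plan (g16) BATCH #274 (1) ∕ #276 (1)), brick
B3-3: A SURVIVING RANK-ONE INDEX OF A SIDE WHOSE FOURIER SUPPORT LIES ON THE GRAMS OF THE LINE `⟨a′⟩` IS A GLOBAL GRAM — `b = a′ · c(e) · e`.
THEOREMS ONLY (no `def`, no `instance`, no notation, no named-fact hypothesis, no `sorry`).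
-/
import Summits.HodgeConjecture.HodgeConjecture.Theorems.K2LiuRankOneLineGram              -- ★ U2c file 1: `eq_mul_conj_mul_self_of_smul_vecMulVec_eq`
import Summits.HodgeConjecture.HodgeConjecture.Theorems.K2LiuSiegelUnipotentFourierDefs    -- ★ `fourierCoeffDelta` (brings `HA`, `unipDelta`, `gramR`, `Fp`)
import Literature.NumberTheory.K2Lit.DoubledLineThetaKernel                                 -- ★ D8 `doubledLineThetaLift` (§3)
import HarnessLib

/-!
# K2_Liu road (hLiu418 = stmt-HodgeConjecture-24832), FACE-D₀ route (B3), brick B3-3: `exists_globalGram_of_cf_thetaSide_ne_zero`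

Cell `pub/hodgecm-mathlib` (D-0151), Track B, build stream 29; helper lane `--supports stmt-HodgeConjecture-24832 --as helper`, count-neutral; closes no socket.

THE JUNCTION (FACE-D₀ desk, K2 bus 2026-09-05T03:12Z; RULING M-160i: every row letter is keyed on the CONJUGATE dictionary
`dict′ β := (−δ) • (T_L⁻¹ · β^{ρ⁻¹})`, `δ = imagUnit L`, `T_L = gramR ⊗ L`).  Route (B3) pays the theta side's rank-one letters `hloc₂′`∕`hsign₂′` of
★ `K2LiuRigidityRowsOfRecordNegKeyed.rigidityRows_of_rowLetters_negKeyed` in three bricks: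
* B3-2 (K2E3-p37, `K2LiuDoubledLineThetaCoeffUnfolding`): the global unfolding of the Fourier coefficient of a doubled line theta lift along
  `N_Δ(L⁺)\N_Δ(𝔸)` as a sum over the rational points `ξ ∈ L²` of the Lagrangian `Δ⁻ ⊗ ⟨a′⟩` with moment `a′ · ξ̄ ⊗ ξ`, whose SUPPORT COROLLARY is the
  one by-value letter consumed here — **`hfib`: «a non-zero coefficient at `dict′ β` forces `β = a′ · ξ̄ ⊗ ξ` for some `ξ : Fin 2 → L`»**
  ([KudlaRallis1994, §3]: Fourier coefficients of theta lifts are supported on represented indices; for a LINE the represented `2 × 2` indices are the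
  rank-`≤ 1` Grams `a′ · ξ̄ ⊗ ξ`);
* B3-3 (THIS FILE): `hfib` ⇒ **(α)'s letter `hgram`: «a surviving rank-one index `b • ū ⊗ u` (`u` with a coordinate `1`) is a GLOBAL Gram of `⟨a′⟩`:
  `b = a′ · c(e) · e` for some `e : L`»** — contract the two Gram presentations with `e_k` (★ U2c `eq_mul_conj_mul_self_of_smul_vecMulVec_eq`);
* (α) (K2E3-p37, `K2LiuRankOneLettersOfGlobalGram`): `hgram` ⇒ `hloc′ ∧ hsign′` (`locF b = locF a′` at every finite place by norm-triviality, `0 < ρ′(b∕a′) =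
  |τ e|²` at every real place).
Contents:
* §1 `exists_eq_mul_conj_mul_self_of_support` — the pure Gram algebra over any commutative ring with a ring endomorphism `σ` and ANY support predicate
  `P` on `ι × ι` matrices: `(∀ β, P β → ∃ ξ, β = a • σ(ξ) ⊗ ξ) → (∃ k, u k = 1) → P (b • σ(u) ⊗ u) → ∃ e, b = a · σ(e) · e`;
* §2 `exists_globalGram_of_fourierCoeff_ne_zero` — the Fourier-coefficient head for ANY family of functions `T : ι → (H(𝔸) → ℂ)` on the doubled group
  (instantiate `T := ⇑T₂` for ED. 2's carrier-level letters, or `T := fun Φ => Θ̃_Φ(fw)` for the `Φ`-level ones), index bytes = ED. 2's; `hgram_of_hfib` (the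
  row shape); `dictNeg_injective` (`dict′` is injective) and `hfib_of_indexMap` — `hfib` from the two outputs of the rational κ-multiplier model (K2E3-p37's
  cut 03:18Z): B3-2b's support corollary in index-map form «`cf_S ≠ 0 ⇒ ∃ ξ, Q ξ = S`» and B3-2c's Gram reading «`Q ξ = dict′(a′ · ξ̄′ ⊗ ξ′)`»;
* §3 `exists_globalGram_of_cf_thetaSide_ne_zero` — the theta side of record: `T₂ x = Θ̃_{𝓣 x}(fw)` pointwise (`hT₂B`, ★ p862640's law), the fibre letter
  `hfibΘ` at the `Φ`-level (B3-2's natural output), the surviving index at the carrier level (ED. 2's `hsign₂′` premise VERBATIM) ⊢ `∃ e, b = a′ · c(e) · e`.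
No definition, no instance, no notation, no named-fact hypothesis, no `sorry`; axioms ⊆ {propext, Classical.choice, Quot.sound}.
HONEST LABEL: `hsign₂′`∕`hloc₂′` are NOT discharged by this file (it is the middle brick; `hfib` is by value until B3-2 is ★); HC_CM is proved only modulo
the 7 printed citations (2 remaining named inputs: hLiu418 = stmt-HodgeConjecture-24832, h413 = stmt-HodgeConjecture-24833) until rung 0 closes; count-neutral.

References: [KudlaRallis1994] S. Kudla, S. Rallis, *A regularized Siegel–Weil formula: the first term identity*, Ann. of Math. 140 (1994), §3;
[Rallis1984] S. Rallis, *Injectivity properties of liftings associated to Weil representations*, Compositio Math. 52 (1984), §4; [Scharlau1985HermitianForms]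
W. Scharlau, *Quadratic and Hermitian Forms*, Springer (1985), Ch. 10 §1; [Liu2021] Y. Liu, Camb. J. Math. 9 (2021), Def. 4.11–4.12, App. B Prop. B.8 p. 104;
[Shimura1997] G. Shimura, *Euler products and Eisenstein series*, CBMS 93 (1997), §18.1 (18.4).
-/

set_option autoImplicit false
set_option linter.dupNamespace false -- the mandated namespace repeats `HodgeConjecture.HodgeConjecture`
-- §3 carries the line datum's `pairRep` telescope; elaborate sequentially (as in ★ p864604 ∕ ★ p864827)
set_option Elab.async false

noncomputable section

open NumberField NumberField.mixedEmbedding MeasureTheory IsDedekindDomain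
open scoped Matrix ComplexOrder ENNReal TensorProduct SchwartzMap

namespace Summit.HodgeConjecture.HodgeConjecture.Cruxes.HLiu418.K2LiuThetaSideRankOneIndexGlobalGram

open Literature.NumberTheory.Automorphic Literature.NumberTheory.Automorphic.UnitaryGroup
open Literature.NumberTheory.Automorphic.IdeleClassGroup
open Literature.NumberTheory.Automorphic.Liu2021
open Literature.NumberTheory.Automorphic.Liu2021.Def411WeilCarriers
open Literature.NumberTheory.Automorphic.Liu2021.Def411WeilCarriersDoubling
open Literature.NumberTheory.GelbartRogawski1991 Literature.NumberTheory.GelbartRogawski1991.UnitaryDualPair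
open Literature.NumberTheory.GelbartRogawski1991.GRConstruction
open Literature.NumberTheory.Weil1964
open Literature.RepresentationTheory Literature.RepresentationTheory.Liu2021
open Literature.NumberTheory.K2Lit.DoubledLineTheta Literature.NumberTheory.K2Lit.SiegelDoubled
open Summit.HodgeConjecture.HodgeConjecture.Cruxes.HLiu418.K2LiuSiegelUnipotentFourierDefs
open Summit.HodgeConjecture.HodgeConjecture.Cruxes.HLiu418.K2LiuRankOneLineGram (eq_mul_conj_mul_self_of_smul_vecMulVec_eq)

/-! ## §1 Gram algebra: a rank-one index supported on the Grams of a line is a Gram of that line -/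

section Gram

variable {R : Type*} [CommRing R] (σ : R →+* R)

/-- **THE NORM READING OF A SUPPORT CONDITION.**  If a predicate `P` on `ι × ι` matrices holds only on Grams `a • σ(ξ) ⊗ ξ` of the line `⟨a⟩`, and
`P` holds at the rank-one matrix `b • σ(u) ⊗ u` with `u` UNIMODULAR at a coordinate (`u k = 1`), then `b = a · σ(e) · e` — `b ∕ a` is a norm
(contract both presentations with `e_k`: ★ `eq_mul_conj_mul_self_of_smul_vecMulVec_eq`, `e = ξ · e_k = ξ k`).
[cite: Scharlau1985HermitianForms, Ch. 10 §1] [cite: KudlaRallis1994, §3] -/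
theorem exists_eq_mul_conj_mul_self_of_support {ι : Type*} [Fintype ι] [DecidableEq ι] (P : Matrix ι ι R → Prop) (a : R)
    (hfib : ∀ β : Matrix ι ι R, P β → ∃ ξ : ι → R, β = a • Matrix.vecMulVec (⇑σ ∘ ξ) ξ)
    {b : R} {u : ι → R} (hu : ∃ k, u k = 1) (hb : P (b • Matrix.vecMulVec (⇑σ ∘ u) u)) :
    ∃ e : R, b = a * (σ e * e) := by
  obtain ⟨ξ, hξ⟩ := hfib _ hb
  obtain ⟨k, hk⟩ := hu
  exact ⟨ξ ⬝ᵥ Pi.single k 1, eq_mul_conj_mul_self_of_smul_vecMulVec_eq σ hξ.symm (Pi.single k 1) (by rw [dotProduct_single, mul_one, hk])⟩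

/-- … the same with the witness named: `e = ξ k` for the fibre point `ξ` over `b • σ(u) ⊗ u`. [cite: Scharlau1985HermitianForms, Ch. 10 §1] -/
theorem eq_mul_conj_mul_self_of_eq_smul_vecMulVec {ι : Type*} [Fintype ι] [DecidableEq ι] {a b : R} {u ξ : ι → R} {k : ι} (hk : u k = 1)
    (hξ : b • Matrix.vecMulVec (⇑σ ∘ u) u = a • Matrix.vecMulVec (⇑σ ∘ ξ) ξ) :
    b = a * (σ (ξ k) * ξ k) := by
  have h := eq_mul_conj_mul_self_of_smul_vecMulVec_eq σ hξ.symm (Pi.single k 1) (by rw [dotProduct_single, mul_one, hk])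
  rwa [dotProduct_single, mul_one] at h

end Gram

/-! ## §2 The Fourier-coefficient head for any family of functions on `H(𝔸)` (index bytes of ED. 2, keying `−δ`) -/

section Coeff

variable (L : Type) [Field L] [NumberField L] [IsCMField L]
variable {N n : ℕ} (e : Fin N × Fin 1 ≃ Fin n)
  (dV : Fin N → L) (hdV : ∀ i, IsCMField.complexConj L (dV i) = dV i)
  (dW : Fin 1 → L) (hdW : ∀ i, IsCMField.complexConj L (dW i) = dW i)
  [MeasurableSpace (unipDelta L e dV hdV dW hdW)] (νN : Measure (unipDelta L e dV hdV dW hdW))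
  (βw : unipDelta L e dV hdV dW hdW → ℝ≥0∞) (ρ : Fin n ≃ Fin 2) (a' : (Fp L)ˣ)

/-- **B3-3 AT THE FOURIER-COEFFICIENT LEVEL, ANY SIDE `T`.**  Let `T : ι → (H(𝔸) → ℂ)` be any family of functions on the doubled group whose Fourier
coefficients along `N_Δ(L⁺)\N_Δ(𝔸)` (covering-weight currency `fourierCoeffDelta νN βw`) at the conjugate-dictionary indices
`(−δ) • (T_L⁻¹ · β^{ρ⁻¹})` are SUPPORTED ON THE GRAMS OF THE LINE `⟨a′⟩` (`hfib`, the support corollary of the global unfolding B3-2).  Then every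
surviving rank-one index `b • ū ⊗ u` (`b ∈ L⁺ˣ`, `u` with a coordinate `1`) is a GLOBAL Gram of `⟨a′⟩`: `b = a′ · c(e) · e` for some `e : L` — the
hypothesis `hgram` of (α) `K2LiuRankOneLettersOfGlobalGram`.  Instantiate `T := ⇑T₂` (carrier level) or `T := fun Φ => Θ̃_Φ(fw)` (`Φ`-level).
[cite: KudlaRallis1994, §3] [cite: Scharlau1985HermitianForms, Ch. 10 §1] [cite: Shimura1997, §18.1 (18.4)] -/
theorem exists_globalGram_of_fourierCoeff_ne_zero {ι : Type*} (T : ι → HA L e dV hdV dW hdW → ℂ)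
    (hfib : ∀ β : Matrix (Fin 2) (Fin 2) L,
      (∃ (x : ι) (h : HA L e dV hdV dW hdW),
        fourierCoeffDelta L e dV hdV dW hdW νN βw
          ((-imagUnit L) • (((gramR L e dV hdV dW hdW).map (algebraMap (Fp L) L))⁻¹ * Matrix.reindex ρ.symm ρ.symm β)) (T x) h ≠ 0) →
      ∃ ξ : Fin 2 → L, β = algebraMap (Fp L) L (a' : Fp L) • Matrix.vecMulVec (⇑(IsCMField.complexConj L) ∘ ξ) ξ)
    (b : (Fp L)ˣ) (u : Fin 2 → L) (hu : ∃ k, u k = 1)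
    (hne : ∃ (x : ι) (h : HA L e dV hdV dW hdW),
      fourierCoeffDelta L e dV hdV dW hdW νN βw
        ((-imagUnit L) • (((gramR L e dV hdV dW hdW).map (algebraMap (Fp L) L))⁻¹ *
          Matrix.reindex ρ.symm ρ.symm (algebraMap (Fp L) L (b : Fp L) • Matrix.vecMulVec (⇑(IsCMField.complexConj L) ∘ u) u))) (T x) h ≠ 0) :
    ∃ e : L, algebraMap (Fp L) L (b : Fp L) = algebraMap (Fp L) L (a' : Fp L) * (IsCMField.complexConj L e * e) :=
  exists_eq_mul_conj_mul_self_of_support (IsCMField.complexConj L : L →+* L)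
    (fun β => ∃ (x : ι) (h : HA L e dV hdV dW hdW),
      fourierCoeffDelta L e dV hdV dW hdW νN βw
        ((-imagUnit L) • (((gramR L e dV hdV dW hdW).map (algebraMap (Fp L) L))⁻¹ * Matrix.reindex ρ.symm ρ.symm β)) (T x) h ≠ 0)
    _ hfib hu hne

/-- **the row shape**: under `hfib`, the implication «surviving rank-one index ⇒ global Gram» for ALL `b`, `u` at once — literally the letter `hgram`
of (α) for the side `T`. [cite: KudlaRallis1994, §3] [cite: Scharlau1985HermitianForms, Ch. 10 §1] -/
theorem hgram_of_hfib {ι : Type*} (T : ι → HA L e dV hdV dW hdW → ℂ)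
    (hfib : ∀ β : Matrix (Fin 2) (Fin 2) L,
      (∃ (x : ι) (h : HA L e dV hdV dW hdW),
        fourierCoeffDelta L e dV hdV dW hdW νN βw
          ((-imagUnit L) • (((gramR L e dV hdV dW hdW).map (algebraMap (Fp L) L))⁻¹ * Matrix.reindex ρ.symm ρ.symm β)) (T x) h ≠ 0) →
      ∃ ξ : Fin 2 → L, β = algebraMap (Fp L) L (a' : Fp L) • Matrix.vecMulVec (⇑(IsCMField.complexConj L) ∘ ξ) ξ) :
    ∀ (b : (Fp L)ˣ) (u : Fin 2 → L), (∃ k, u k = 1) →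
      (∃ (x : ι) (h : HA L e dV hdV dW hdW),
        fourierCoeffDelta L e dV hdV dW hdW νN βw
          ((-imagUnit L) • (((gramR L e dV hdV dW hdW).map (algebraMap (Fp L) L))⁻¹ *
            Matrix.reindex ρ.symm ρ.symm (algebraMap (Fp L) L (b : Fp L) • Matrix.vecMulVec (⇑(IsCMField.complexConj L) ∘ u) u))) (T x) h ≠ 0) →
      ∃ e : L, algebraMap (Fp L) L (b : Fp L) = algebraMap (Fp L) L (a' : Fp L) * (IsCMField.complexConj L e * e) :=
  fun b u hu hne => exists_globalGram_of_fourierCoeff_ne_zero L e dV hdV dW hdW νN βw ρ a' T hfib b u hu hne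

omit [MeasurableSpace (unipDelta L e dV hdV dW hdW)] in
/-- **THE CONJUGATE DICTIONARY IS INJECTIVE**: `(−δ) • (T_L⁻¹ · β^{ρ⁻¹}) = (−δ) • (T_L⁻¹ · β′^{ρ⁻¹}) → β = β′` (`δ ≠ 0`, `T_L = gramR ⊗ L` has unit
determinant when no `dV i`, `dW j` vanishes, `reindex` is a bijection). [cite: Shimura1997, §18.1 (18.4)] -/
theorem dictNeg_injective (hdV0 : ∀ i, dV i ≠ 0) (hdW0 : ∀ i, dW i ≠ 0) {β β' : Matrix (Fin 2) (Fin 2) L}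
    (h : (-imagUnit L) • (((gramR L e dV hdV dW hdW).map (algebraMap (Fp L) L))⁻¹ * Matrix.reindex ρ.symm ρ.symm β) =
      (-imagUnit L) • (((gramR L e dV hdV dW hdW).map (algebraMap (Fp L) L))⁻¹ * Matrix.reindex ρ.symm ρ.symm β')) :
    β = β' := by
  have hTu : IsUnit ((gramR L e dV hdV dW hdW).map (algebraMap (Fp L) L)).det := by
    rw [← RingHom.mapMatrix_apply, ← RingHom.map_det]
    exact (isUnit_det_gram (Fp L) e (isUnit_det_realDiagonal L dV hdV hdV0) (isUnit_det_realDiagonal L dW hdW hdW0)).map _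
  have h1 := smul_right_injective (Matrix (Fin n) (Fin n) L) (neg_ne_zero.2 (imagUnit_ne_zero L)) h
  have h2 : Matrix.reindex ρ.symm ρ.symm β = Matrix.reindex ρ.symm ρ.symm β' := by
    have := congrArg (fun M => ((gramR L e dV hdV dW hdW).map (algebraMap (Fp L) L)) * M) h1
    simpa only [Matrix.mul_nonsing_inv_cancel_left _ _ hTu] using this
  exact (Matrix.reindex ρ.symm ρ.symm).injective h2

/-- **`hfib` FROM A MULTIPLIER INDEX MAP (the shape of B3-2b∕B3-2c's outputs).**  If the Fourier coefficients of the family `T` are supported on the values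
of an index map `Q : X → M_n(L)` (`hsupp`, B3-2b's support corollary `exists_index_eq_of_cf_thetaSide_ne_zero` in `Q`-form: «`cf_S ≠ 0 ⇒ ∃ ξ, Q ξ = S`»),
and every value of `Q` is the conjugate-dictionary image of a Gram of the line `⟨a′⟩` (`hQ`, B3-2c's Gram reading of the rational κ-multiplier model), then
`hfib` holds for `T`: a non-zero coefficient at `dict′ β` forces `β = a′ · ξ̄ ⊗ ξ` (injectivity of `dict′`, `dictNeg_injective`).
[cite: KudlaRallis1994, §3] [cite: Shimura1997, §18.1 (18.4)] -/
theorem hfib_of_indexMap (hdV0 : ∀ i, dV i ≠ 0) (hdW0 : ∀ i, dW i ≠ 0) {ι X : Type*} (T : ι → HA L e dV hdV dW hdW → ℂ)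
    (Q : X → Matrix (Fin n) (Fin n) L)
    (hQ : ∀ ξ : X, ∃ ξ' : Fin 2 → L, Q ξ = (-imagUnit L) • (((gramR L e dV hdV dW hdW).map (algebraMap (Fp L) L))⁻¹ *
      Matrix.reindex ρ.symm ρ.symm (algebraMap (Fp L) L (a' : Fp L) • Matrix.vecMulVec (⇑(IsCMField.complexConj L) ∘ ξ') ξ')))
    (hsupp : ∀ S : Matrix (Fin n) (Fin n) L, (∃ (x : ι) (h : HA L e dV hdV dW hdW), fourierCoeffDelta L e dV hdV dW hdW νN βw S (T x) h ≠ 0) →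
      ∃ ξ : X, Q ξ = S) :
    ∀ β : Matrix (Fin 2) (Fin 2) L,
      (∃ (x : ι) (h : HA L e dV hdV dW hdW),
        fourierCoeffDelta L e dV hdV dW hdW νN βw
          ((-imagUnit L) • (((gramR L e dV hdV dW hdW).map (algebraMap (Fp L) L))⁻¹ * Matrix.reindex ρ.symm ρ.symm β)) (T x) h ≠ 0) →
      ∃ ξ : Fin 2 → L, β = algebraMap (Fp L) L (a' : Fp L) • Matrix.vecMulVec (⇑(IsCMField.complexConj L) ∘ ξ) ξ := by
  intro β hβ
  obtain ⟨ξ, hξ⟩ := hsupp _ hβ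
  obtain ⟨ξ', hξ'⟩ := hQ ξ
  exact ⟨ξ', dictNeg_injective L e dV hdV dW hdW ρ hdV0 hdW0 (hξ.symm.trans hξ')⟩

end Coeff

/-! ## §3 The theta side of record: `T₂ x = Θ̃_{𝓣 x}(fw)` -/

section Theta

variable (L : Type) [Field L] [NumberField L] [IsCMField L]
variable {N n : ℕ} (e : Fin N × Fin 1 ≃ Fin n)
  (dV : Fin N → L) (hdV : ∀ i, IsCMField.complexConj L (dV i) = dV i)
  (dW : Fin 1 → L) (hdW : ∀ i, IsCMField.complexConj L (dW i) = dW i)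
  {n'' : ℕ} (e₁ : Fin (n + n) × Fin 1 ≃ Fin n'')
  (hdV0 : ∀ i, dV i ≠ 0) (hdW0 : ∀ i, dW i ≠ 0)
  (lam : IdeleClassGroup L →ₜ* Circle) (hlam : IsConjugateSymplectic L lam) (a' : (Fp L)ˣ)
  (hρ : HasThetaMajorants fun
      (p : ↥(UnitaryGroup.adelic (Fp L) L (IsCMField.complexConj L) (n + n) (Matrix.diagonal (dD L e dV hdV dW hdW))) ×
        ↥(UnitaryGroup.adelic (Fp L) L (IsCMField.complexConj L) 1 (JW (Fp L) L a')))
      (Φ : piSchwartzBruhat (Fp L) (Fin n'')) =>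
        pairRep (Fp L) L (IsCMField.complexConj L) (n + n) 1 e₁ (Matrix.diagonal (dD L e dV hdV dW hdW)) (JW (Fp L) L a')
          (chiSplittingLine L e₁ (dD L e dV hdV dW hdW) (dD_conj L e dV hdV dW hdW) (dD_ne_zero L e dV hdV dW hdW hdV0 hdW0)
            (toHeckeCharacter L lam) (isUnitary_toHeckeCharacter L lam)
            ((isOscillatorChar_toHeckeCharacter_iff lam).mpr hlam) (TW (Fp L) a')
            (isUnit_det_TW (Fp L) a') (JW (Fp L) L a') (JW_eq (Fp L) L a'))
          p Φ)
  [MeasurableSpace (↥(UnitaryGroup.adelic (Fp L) L (IsCMField.complexConj L) 1 (JW (Fp L) L a')) ⧸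
    (UnitaryGroup.toAdelic (Fp L) L (IsCMField.complexConj L) 1 (JW (Fp L) L a')).range)]
  (μW : Measure (↥(UnitaryGroup.adelic (Fp L) L (IsCMField.complexConj L) 1 (JW (Fp L) L a')) ⧸
    (UnitaryGroup.toAdelic (Fp L) L (IsCMField.complexConj L) 1 (JW (Fp L) L a')).range))
  (fw : C(↥(UnitaryGroup.adelic (Fp L) L (IsCMField.complexConj L) 1 (JW (Fp L) L a')) ⧸
    (UnitaryGroup.toAdelic (Fp L) L (IsCMField.complexConj L) 1 (JW (Fp L) L a')).range, ℂ))
  [MeasurableSpace (unipDelta L e dV hdV dW hdW)] (νN : Measure (unipDelta L e dV hdV dW hdW))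
  (βw : unipDelta L e dV hdV dW hdW → ℝ≥0∞) (ρ : Fin n ≃ Fin 2)

set_option maxHeartbeats 1000000 in -- the statement carries the line datum's `pairRep` telescope (as ★ p864604's heads)
/-- **B3-3 FOR THE THETA SIDE OF RECORD — `exists_globalGram_of_cf_thetaSide_ne_zero`.**  For a side `T₂` on a carrier `D` that IS the doubled line theta
lift after the Schwartz-side map `𝓣` (`hT₂B : T₂ x h = Θ̃_{𝓣 x}(fw)(h)`, ★ p862640 `exists_thetaFunctional`), the `Φ`-LEVEL fibre letter of B3-2 for the
theta lifts `Φ ↦ Θ̃_Φ(fw)` (`hfibΘ`: a non-zero coefficient of some `Θ̃_Φ(fw)` at `(−δ) • (T_L⁻¹ · β^{ρ⁻¹})` forces `β = a′ · ξ̄ ⊗ ξ`) turns ED. 2's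
`hsign₂′`∕`hloc₂`-premise «the coefficient of some `T₂ x` at the index of `b • ū ⊗ u` is non-zero at some `h`» into (α)'s letter: **`b = a′ · c(e) · e` for
some `e : L`**. [cite: KudlaRallis1994, §3] [cite: Liu2021, Def. 4.11–4.12; App. B Prop. B.8 p. 104] [cite: Scharlau1985HermitianForms, Ch. 10 §1] -/
theorem exists_globalGram_of_cf_thetaSide_ne_zero {D : Type*} (𝓣 : D → piSchwartzBruhat (Fp L) (Fin n'')) (T₂ : D → HA L e dV hdV dW hdW → ℂ)
    (hT₂B : ∀ x (h : HA L e dV hdV dW hdW), T₂ x h = doubledLineThetaLift L e dV hdV dW hdW e₁ hdV0 hdW0 lam hlam a' hρ μW (𝓣 x) fw h)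
    (hfibΘ : ∀ β : Matrix (Fin 2) (Fin 2) L,
      (∃ (Φ : piSchwartzBruhat (Fp L) (Fin n'')) (h : HA L e dV hdV dW hdW),
        fourierCoeffDelta L e dV hdV dW hdW νN βw
          ((-imagUnit L) • (((gramR L e dV hdV dW hdW).map (algebraMap (Fp L) L))⁻¹ * Matrix.reindex ρ.symm ρ.symm β))
          (doubledLineThetaLift L e dV hdV dW hdW e₁ hdV0 hdW0 lam hlam a' hρ μW Φ fw) h ≠ 0) →
      ∃ ξ : Fin 2 → L, β = algebraMap (Fp L) L (a' : Fp L) • Matrix.vecMulVec (⇑(IsCMField.complexConj L) ∘ ξ) ξ)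
    (b : (Fp L)ˣ) (u : Fin 2 → L) (hu : ∃ k, u k = 1)
    (hne : ∃ (x : D) (h : HA L e dV hdV dW hdW),
      fourierCoeffDelta L e dV hdV dW hdW νN βw
        ((-imagUnit L) • (((gramR L e dV hdV dW hdW).map (algebraMap (Fp L) L))⁻¹ *
          Matrix.reindex ρ.symm ρ.symm (algebraMap (Fp L) L (b : Fp L) • Matrix.vecMulVec (⇑(IsCMField.complexConj L) ∘ u) u))) (T₂ x) h ≠ 0) :
    ∃ e : L, algebraMap (Fp L) L (b : Fp L) = algebraMap (Fp L) L (a' : Fp L) * (IsCMField.complexConj L e * e) := by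
  -- read the carrier-level witness at the `Φ`-level through `hT₂B`, then §2 for the family `Φ ↦ Θ̃_Φ(fw)`
  refine exists_globalGram_of_fourierCoeff_ne_zero L e dV hdV dW hdW νN βw ρ a'
    (fun Φ => doubledLineThetaLift L e dV hdV dW hdW e₁ hdV0 hdW0 lam hlam a' hρ μW Φ fw) hfibΘ b u hu ?_
  obtain ⟨x, h, hxh⟩ := hne
  have hx : T₂ x = doubledLineThetaLift L e dV hdV dW hdW e₁ hdV0 hdW0 lam hlam a' hρ μW (𝓣 x) fw := funext (hT₂B x)
  exact ⟨𝓣 x, h, hx ▸ hxh⟩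

end Theta

end Summit.HodgeConjecture.HodgeConjecture.Cruxes.HLiu418.K2LiuThetaSideRankOneIndexGlobalGram

end
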